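import Summits.NavierStokesRegularity.NavierStokesRegularity.Theorems.SoloSalvageShlygin2026Tools
import Literature.Analysis.FluidPDE.ESSBackwardUniquenessHolds
import HarnessLib

/-!
# NS-claims map, C151 (Shlygin 2026): the cited backward-uniqueness theorem (Thm 2.7) is TRUE —
# whole-space backward uniqueness for parabolic systems with bounded lower-order terms (salvage, kernel)

Claim C151 of cell `ns-claims` (D-0090): Maximus Shlygin, *Navier–Stokes existence and smoothness:
complete proof*, Zenodo record 18507509 (bib `Shlygin2026`), skeleton
`Literature.Claims.NS.Shlygin2026` (typist ns-claims-typist-1 g5).  Theorem 2.7 p.3 l.63–73 (cited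
there to Escauriaza–Seregin–Šverák 2003) is typed as `Theorem27_BackwardUniqueness`: a `C²` (on the
closed slab `[t₁, t₂] × ℝ³`) solution `v` of `∂ₜv − νΔv + b·∇v + c v = 0` with bounded coefficients and
Gaussian growth `|v| ≤ C_a e^{a|x|²}` which vanishes at the final time `t₂` vanishes on the whole slab.
This is classical, and in fact a special case of the much harder half-space theorem of
Escauriaza–Seregin–Šverák (Russ. Math. Surveys 58 (2003), Thm. 5.1 = Seregin 2014, Thm. A.3.5),
which the tree PROVES (`Literature.Analysis.FluidPDE.ess_backward_uniqueness_holds`).  We derive the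
typed statement from it (part 2 of 2; tools in `SoloSalvageShlygin2026Tools.lean`): for a target point
`x⋆` and a unit vector `e`, the pulled-back field `u(s, y) = C⁻¹ v(t₂ − α s, x⋆ − β e + β y)`,
`α = t₂ − t₁`, `β = √(αν)`, lives on ESS's domain `(0,1) × {⟪y, e⟫ > 0}`, vanishes at `s = 0`,
satisfies `|∂ₛu + Δu| ≤ c₁(|∇u| + |u|)` (the equation, with `β² = αν`) and `|u| ≤ e^{M|y|²}` (the
constant absorbed into `C`), and is `C²` up to the boundary of the slab, so the local `W^{2,1}_2`
bounds are bounds of continuous functions on compact sets; ESS gives `u ≡ 0`, i.e. `v(t, x⋆) = 0`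
for `t₁ < t < t₂`, and `t = t₁` follows by continuity.

* `theorem27_holds : Literature.Claims.NS.Shlygin2026.Theorem27_BackwardUniqueness`.

Records-grade TRUE-column object (the located step of row C151 is the refuter's `Theorem25`); chair
RULINGS 2026-08-27 11:31Z (3).  Salvage seat ns-claims-salvage-p4 g4.  Axioms: `propext`,
`Classical.choice`, `Quot.sound` only.
WHAT THIS IS NOT: not a claim about NS regularity or blow-up; not a claim about any author beyond
the typed locator.
-/

noncomputable section

open MeasureTheory Set Filter Function Metric
open scoped ENNReal NNReal Topology RealInnerProductSpace InnerProductSpace Laplacian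

-- The summit's canonical theorem namespace repeats the summit name (single-conjunct summit).
set_option linter.dupNamespace false

namespace Summit.NavierStokesRegularity.NavierStokesRegularity.Theorems.Shlygin2026

open Literature.Analysis.FluidPDE Literature.Claims.NS.Shlygin2026
open Literature.Analysis.Calculus

/-! ## The twin -/

set_option maxHeartbeats 400000 in
/-- **Theorem 2.7 holds** — backward uniqueness on `ℝ³ × [t₁, t₂]` for `∂ₜv − νΔv + b·∇v + cv = 0`
with bounded `b, c` under Gaussian growth: `v(·, t₂) = 0 ⇒ v ≡ 0` (p.3 l.63–73, cited there to
Escauriaza–Seregin–Šverák 2003).  Derived from the tree's PROVED half-space theorem of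
Escauriaza–Seregin–Šverák / Seregin (`ess_backward_uniqueness_holds`) by the pull-back
`u(s,y) = C⁻¹ v(t₂ − (t₂−t₁)s, x⋆ − βe + βy)`, `β² = (t₂−t₁)ν`.
[cite: Shlygin2026, Thm 2.7 p.3 l.63–73] [cite: EscauriazaSereginSverak2003, Thm. 5.1]
[cite: Seregin2014, App. A.3 Thm. 3.5] -/
theorem theorem27_holds : Theorem27_BackwardUniqueness := by
  intro ν hν t₁ t₂ ht v b c hC2 hbc hgr heq hzero
  obtain ⟨K, hK⟩ := hbc
  obtain ⟨a, Ca, hgr⟩ := hgr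
  -- it suffices to prove vanishing at interior times
  suffices hint : ∀ t ∈ Ioo t₁ t₂, ∀ x, v t x = 0 by
    intro t htI x
    rcases eq_or_lt_of_le htI.2 with h2 | hlt2
    · rw [h2]; exact hzero x
    rcases eq_or_lt_of_le htI.1 with h1 | hlt1
    · rw [← h1]; exact eq_zero_left_endpoint hC2 ht x (fun s hs => hint s hs x)
    · exact hint t ⟨hlt1, hlt2⟩ x
  intro t htI xs
  -- parameters of the pull-back
  have hα0 : 0 < t₂ - t₁ := by linarith
  obtain ⟨β, hβ⟩ : ∃ β : ℝ, β = Real.sqrt ((t₂ - t₁) * ν) := ⟨_, rfl⟩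
  have hβ0 : 0 < β := by rw [hβ]; exact Real.sqrt_pos.2 (mul_pos hα0 hν)
  have hβsq : β ^ 2 = (t₂ - t₁) * ν := by rw [hβ]; exact Real.sq_sqrt (mul_pos hα0 hν).le
  obtain ⟨e, hen⟩ := exists_norm_eq E3 zero_le_one
  obtain ⟨x₀, hx₀⟩ : ∃ x₀ : E3, x₀ = xs - β • e := ⟨_, rfl⟩
  have hX : x₀ + β • e = xs := by rw [hx₀]; abel
  have hK0 : 0 ≤ K := (norm_nonneg (b t₁ 0)).trans (hK t₁ (left_mem_Icc.2 ht.le) 0).1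
  obtain ⟨a', ha'⟩ : ∃ a' : ℝ, a' = max a 0 := ⟨_, rfl⟩
  have ha'0 : 0 ≤ a' := by rw [ha']; exact le_max_right _ _
  have haa' : a ≤ a' := by rw [ha']; exact le_max_left _ _
  obtain ⟨C, hC⟩ : ∃ C : ℝ, C = max Ca 1 * Real.exp (2 * a' * ‖x₀‖ ^ 2) := ⟨_, rfl⟩
  have hCa1 : Ca ≤ max Ca 1 := le_max_left _ _
  have hC0 : 0 < C := by
    rw [hC]; exact mul_pos (lt_of_lt_of_le one_pos (le_max_right _ _)) (Real.exp_pos _)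
  have hCi : 0 < C⁻¹ := inv_pos.2 hC0
  -- the pulled-back field and the half-space
  obtain ⟨u, hu⟩ : ∃ u : ℝ → E3 → E3, u = (C⁻¹ • stPull (-(t₂ - t₁)) β t₂ x₀ v) := ⟨_, rfl⟩
  -- (1) regularity of `u`
  have hC2u : ContDiffOn ℝ 2 (uncurry u) (Ioo 0 1 ×ˢ {y : E3 | 0 < ⟪y, e⟫_ℝ}) := by
    rw [hu]
    exact (contDiffOn_pull hC2 ht C β x₀).mono (prod_mono Ioo_subset_Icc_self (subset_univ _))
  have hcontu : ContinuousOn (uncurry u) (Ico 0 1 ×ˢ {y : E3 | 0 < ⟪y, e⟫_ℝ}) := by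
    rw [hu]; exact continuousOn_pull hC2 ht C β x₀ _
  -- (2) vanishing at `s = 0`
  have hz0 : ∀ y : E3, 0 < ⟪y, e⟫_ℝ → u 0 y = 0 := by
    intro y _
    rw [hu, pull_apply]
    simp [hzero]
  -- (3) the equation at the image point, for interior `s`
  have hPDE : ∀ s ∈ Ioo (0 : ℝ) 1, ∀ y : E3,
      timeDeriv v (t₂ + -(t₂ - t₁) * s) (x₀ + β • y) =
        ν • (Δ (v (t₂ + -(t₂ - t₁) * s))) (x₀ + β • y) -
          fderiv ℝ (v (t₂ + -(t₂ - t₁) * s)) (x₀ + β • y) (b (t₂ + -(t₂ - t₁) * s) (x₀ + β • y)) -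
          c (t₂ + -(t₂ - t₁) * s) (x₀ + β • y) (v (t₂ + -(t₂ - t₁) * s) (x₀ + β • y)) := by
    intro s hs y
    have hT := time_mem_Ioo ht hs
    have h1 := heq _ (Ioo_subset_Icc_self hT) (x₀ + β • y)
    rw [timeDerivWithin_eq_timeDeriv hT] at h1
    rw [← sub_eq_zero, ← h1]
    abel
  -- (4) the differential inequality `|∂ₛu + Δu| ≤ c₁ (|∇u| + |u|)`
  have hineq : ∀ s ∈ Ioo (0 : ℝ) 1, ∀ y : E3, 0 < ⟪y, e⟫_ℝ →
      ‖timeDeriv u s y + (Δ (u s)) y‖ ≤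
        ((t₂ - t₁) * K * (β⁻¹ + 1)) * (‖fderiv ℝ (u s) y‖ + ‖u s y‖) := by
    intro s hs y _
    have hT := time_mem_Ioo ht hs
    have hTI : t₂ + -(t₂ - t₁) * s ∈ Icc t₁ t₂ := Ioo_subset_Icc_self hT
    -- shorthand for the data of `v` at the image point
    obtain ⟨L, hL⟩ : ∃ L : E3, L = (Δ (v (t₂ + -(t₂ - t₁) * s))) (x₀ + β • y) := ⟨_, rfl⟩
    obtain ⟨Dv, hDv⟩ : ∃ Dv : E3 →L[ℝ] E3, Dv = fderiv ℝ (v (t₂ + -(t₂ - t₁) * s)) (x₀ + β • y) :=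
      ⟨_, rfl⟩
    obtain ⟨w, hw⟩ : ∃ w : E3, w = v (t₂ + -(t₂ - t₁) * s) (x₀ + β • y) := ⟨_, rfl⟩
    obtain ⟨F, hF⟩ : ∃ F : E3, F = Dv (b (t₂ + -(t₂ - t₁) * s) (x₀ + β • y)) := ⟨_, rfl⟩
    obtain ⟨G, hG⟩ : ∃ G : E3, G = c (t₂ + -(t₂ - t₁) * s) (x₀ + β • y) w := ⟨_, rfl⟩
    obtain ⟨q, hq⟩ : ∃ q : ℝ, q = C⁻¹ * (t₂ - t₁) := ⟨_, rfl⟩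
    have hq0 : 0 < q := by rw [hq]; positivity
    have e_td : timeDeriv u s y = (-q) • (ν • L - F - G) := by
      rw [hu, timeDeriv_pull hC2 ht C β x₀ hs y, hPDE s hs y, hL, hF, hG, hDv, hw, hq]
      congr 1; ring
    have e_lap : (Δ (u s)) y = (q * ν) • L := by
      rw [hu, laplacian_pull hC2 ht C β x₀ hs y, hβsq, hL, hq]
      congr 1; ring
    have e_fd : ‖fderiv ℝ (u s) y‖ = C⁻¹ * β * ‖Dv‖ := by
      rw [hu, fderiv_pull hC2 ht C β x₀ hs y, hDv, norm_smul, Real.norm_eq_abs,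
        abs_of_pos (mul_pos hCi hβ0)]
    have e_u : ‖u s y‖ = C⁻¹ * ‖w‖ := by
      rw [hu, pull_apply, hw, norm_smul, Real.norm_eq_abs, abs_of_pos hCi]
    have hlhs : timeDeriv u s y + (Δ (u s)) y = q • (F + G) := by
      rw [e_td, e_lap, neg_smul, smul_sub, smul_sub, smul_smul, smul_add]
      abel
    have hFle : ‖F‖ ≤ K * ‖Dv‖ := by
      rw [hF]
      calc ‖Dv (b (t₂ + -(t₂ - t₁) * s) (x₀ + β • y))‖
          ≤ ‖Dv‖ * ‖b (t₂ + -(t₂ - t₁) * s) (x₀ + β • y)‖ := ContinuousLinearMap.le_opNorm _ _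
        _ ≤ ‖Dv‖ * K := mul_le_mul_of_nonneg_left (hK _ hTI _).1 (norm_nonneg _)
        _ = K * ‖Dv‖ := mul_comm _ _
    have hGle : ‖G‖ ≤ K * ‖w‖ := by
      rw [hG]
      calc ‖c (t₂ + -(t₂ - t₁) * s) (x₀ + β • y) w‖
          ≤ ‖c (t₂ + -(t₂ - t₁) * s) (x₀ + β • y)‖ * ‖w‖ := ContinuousLinearMap.le_opNorm _ _
        _ ≤ K * ‖w‖ := mul_le_mul_of_nonneg_right (hK _ hTI _).2 (norm_nonneg _)
    rw [hlhs, norm_smul, Real.norm_eq_abs, abs_of_pos hq0, e_fd, e_u]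
    have hFG : ‖F + G‖ ≤ K * ‖Dv‖ + K * ‖w‖ := (norm_add_le _ _).trans (add_le_add hFle hGle)
    have hβi : 0 < β⁻¹ := inv_pos.2 hβ0
    have key : q * (K * ‖Dv‖ + K * ‖w‖) =
        (t₂ - t₁) * K * (β⁻¹ * (C⁻¹ * β * ‖Dv‖) + C⁻¹ * ‖w‖) := by
      rw [hq]; field_simp
    have h1 : 0 ≤ C⁻¹ * β * ‖Dv‖ := by positivity
    have h2 : 0 ≤ C⁻¹ * ‖w‖ := by positivity
    have h3 : 0 ≤ (t₂ - t₁) * K := by positivity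
    calc q * ‖F + G‖ ≤ q * (K * ‖Dv‖ + K * ‖w‖) := mul_le_mul_of_nonneg_left hFG hq0.le
      _ = (t₂ - t₁) * K * (β⁻¹ * (C⁻¹ * β * ‖Dv‖) + C⁻¹ * ‖w‖) := key
      _ ≤ (t₂ - t₁) * K * (β⁻¹ + 1) * (C⁻¹ * β * ‖Dv‖ + C⁻¹ * ‖w‖) := by
          nlinarith [mul_nonneg h3 h1, mul_nonneg h3 h2, mul_nonneg (mul_nonneg h3 h1) hβi.le,
            mul_nonneg (mul_nonneg h3 h2) hβi.le]
  -- (5) Gaussian growth `|u| ≤ e^{M |y|²}`, `M = 2 a' β²`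
  have hgrowth : ∀ s ∈ Ioo (0 : ℝ) 1, ∀ y : E3, 0 < ⟪y, e⟫_ℝ →
      ‖u s y‖ ≤ Real.exp (2 * a' * β ^ 2 * ‖y‖ ^ 2) := by
    intro s hs y _
    have hT := time_mem_Ioo ht hs
    have hTI : t₂ + -(t₂ - t₁) * s ∈ Icc t₁ t₂ := Ioo_subset_Icc_self hT
    obtain ⟨X, hXd⟩ : ∃ X : E3, X = x₀ + β • y := ⟨_, rfl⟩
    have e_u : ‖u s y‖ = C⁻¹ * ‖v (t₂ + -(t₂ - t₁) * s) X‖ := by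
      rw [hu, pull_apply, hXd, norm_smul, Real.norm_eq_abs, abs_of_pos hCi]
    rw [e_u]
    have hv := hgr _ hTI X
    have hXn : ‖X‖ ^ 2 ≤ 2 * ‖x₀‖ ^ 2 + 2 * β ^ 2 * ‖y‖ ^ 2 := by
      have h1 : ‖X‖ ≤ ‖x₀‖ + β * ‖y‖ := by
        rw [hXd]
        calc ‖x₀ + β • y‖ ≤ ‖x₀‖ + ‖β • y‖ := norm_add_le _ _
          _ = ‖x₀‖ + β * ‖y‖ := by rw [norm_smul, Real.norm_eq_abs, abs_of_pos hβ0]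
      nlinarith [norm_nonneg X, norm_nonneg x₀, mul_nonneg hβ0.le (norm_nonneg y),
        sq_nonneg (‖x₀‖ - β * ‖y‖)]
    have hexp : Real.exp (a * ‖X‖ ^ 2) ≤
        Real.exp (2 * a' * ‖x₀‖ ^ 2) * Real.exp (2 * a' * β ^ 2 * ‖y‖ ^ 2) := by
      rw [← Real.exp_add]
      refine Real.exp_le_exp.2 ?_
      have : a * ‖X‖ ^ 2 ≤ a' * ‖X‖ ^ 2 := mul_le_mul_of_nonneg_right haa' (sq_nonneg _)
      nlinarith [mul_le_mul_of_nonneg_left hXn ha'0]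
    have hvle : ‖v (t₂ + -(t₂ - t₁) * s) X‖ ≤ C * Real.exp (2 * a' * β ^ 2 * ‖y‖ ^ 2) := by
      calc ‖v (t₂ + -(t₂ - t₁) * s) X‖ ≤ Ca * Real.exp (a * ‖X‖ ^ 2) := hv
        _ ≤ max Ca 1 * Real.exp (a * ‖X‖ ^ 2) :=
            mul_le_mul_of_nonneg_right hCa1 (Real.exp_pos _).le
        _ ≤ max Ca 1 * (Real.exp (2 * a' * ‖x₀‖ ^ 2) * Real.exp (2 * a' * β ^ 2 * ‖y‖ ^ 2)) :=
            mul_le_mul_of_nonneg_left hexp (le_trans zero_le_one (le_max_right _ _))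
        _ = C * Real.exp (2 * a' * β ^ 2 * ‖y‖ ^ 2) := by rw [hC]; ring
    calc C⁻¹ * ‖v (t₂ + -(t₂ - t₁) * s) X‖ ≤ C⁻¹ * (C * Real.exp (2 * a' * β ^ 2 * ‖y‖ ^ 2)) :=
          mul_le_mul_of_nonneg_left hvle hCi.le
      _ = Real.exp (2 * a' * β ^ 2 * ‖y‖ ^ 2) := by field_simp
  -- (6) local `W^{2,1}_2` bounds: bounded continuous data on compact sets
  have hW : ∀ K' ⊆ Ioo (0 : ℝ) 1 ×ˢ {y : E3 | 0 < ⟪y, e⟫_ℝ}, Bornology.IsBounded K' →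
      MeasurableSet K' →
      ∫⁻ z in K', (‖u z.1 z.2‖ₑ ^ 2 + ‖timeDeriv u z.1 z.2‖ₑ ^ 2 +
        ‖iteratedFDeriv ℝ 2 (u z.1) z.2‖ₑ ^ 2) < ⊤ := by
    intro K' hKsub hKb hKm
    obtain ⟨R, hR⟩ := hKb.subset_closedBall 0
    obtain ⟨B, hB0, hB⟩ := exists_bounds_on_closedBall hC2 ht x₀ (β * R)
    obtain ⟨D, hD⟩ : ∃ D : ℝ,
        D = (C⁻¹ * B) ^ 2 + (C⁻¹ * (t₂ - t₁) * B) ^ 2 + (C⁻¹ * β ^ 2 * B) ^ 2 := ⟨_, rfl⟩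
    -- pointwise bound on `K'`
    have hpt : ∀ z ∈ K', ‖u z.1 z.2‖ₑ ^ 2 + ‖timeDeriv u z.1 z.2‖ₑ ^ 2 +
        ‖iteratedFDeriv ℝ 2 (u z.1) z.2‖ₑ ^ 2 ≤ ENNReal.ofReal D := by
      intro z hz
      have hs : z.1 ∈ Ioo (0 : ℝ) 1 := (hKsub hz).1
      have hT := time_mem_Ioo ht hs
      have hzR : ‖z‖ ≤ R := mem_closedBall_zero_iff.mp (hR hz)
      have hyR : ‖z.2‖ ≤ R := (norm_snd_le z).trans hzR
      have hXball : x₀ + β • z.2 ∈ closedBall x₀ (β * R) := by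
        rw [mem_closedBall, dist_eq_norm, add_sub_cancel_left, norm_smul, Real.norm_eq_abs,
          abs_of_pos hβ0]
        exact mul_le_mul_of_nonneg_left hyR hβ0.le
      obtain ⟨b0, b1, b2⟩ := hB _ hT _ hXball
      have n0 : ‖u z.1 z.2‖ ≤ C⁻¹ * B := by
        rw [hu, pull_apply, norm_smul, Real.norm_eq_abs, abs_of_pos hCi]
        exact mul_le_mul_of_nonneg_left b0 hCi.le
      have n1 : ‖timeDeriv u z.1 z.2‖ ≤ C⁻¹ * (t₂ - t₁) * B := by
        rw [hu, timeDeriv_pull hC2 ht C β x₀ hs z.2, norm_smul, Real.norm_eq_abs]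
        have : |C⁻¹ * -(t₂ - t₁)| = C⁻¹ * (t₂ - t₁) := by
          rw [abs_mul, abs_of_pos hCi, abs_neg, abs_of_pos hα0]
        rw [this]
        exact mul_le_mul_of_nonneg_left b1 (by positivity)
      have n2 : ‖iteratedFDeriv ℝ 2 (u z.1) z.2‖ ≤ C⁻¹ * β ^ 2 * B := by
        rw [hu]
        exact (norm_iteratedFDeriv_two_pull_le hC2 ht hC0 β x₀ hs z.2).trans
          (mul_le_mul_of_nonneg_left b2 (by positivity))
      -- pass to `ℝ≥0∞`
      have e0 : ‖u z.1 z.2‖ₑ ^ 2 = ENNReal.ofReal (‖u z.1 z.2‖ ^ 2) := by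
        rw [← ofReal_norm, ENNReal.ofReal_pow (norm_nonneg _)]
      have e1 : ‖timeDeriv u z.1 z.2‖ₑ ^ 2 = ENNReal.ofReal (‖timeDeriv u z.1 z.2‖ ^ 2) := by
        rw [← ofReal_norm, ENNReal.ofReal_pow (norm_nonneg _)]
      have e2 : ‖iteratedFDeriv ℝ 2 (u z.1) z.2‖ₑ ^ 2 =
          ENNReal.ofReal (‖iteratedFDeriv ℝ 2 (u z.1) z.2‖ ^ 2) := by
        rw [← ofReal_norm, ENNReal.ofReal_pow (norm_nonneg _)]
      rw [e0, e1, e2, ← ENNReal.ofReal_add (sq_nonneg _) (sq_nonneg _),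
        ← ENNReal.ofReal_add (add_nonneg (sq_nonneg _) (sq_nonneg _)) (sq_nonneg _)]
      refine ENNReal.ofReal_le_ofReal ?_
      rw [hD]
      have p0 := pow_le_pow_left₀ (norm_nonneg _) n0 2
      have p1 := pow_le_pow_left₀ (norm_nonneg _) n1 2
      have p2 := pow_le_pow_left₀ (norm_nonneg _) n2 2
      linarith
    refine lt_of_le_of_lt (setLIntegral_mono' hKm hpt) ?_
    rw [setLIntegral_const]
    exact ENNReal.mul_lt_top ENNReal.ofReal_lt_top hKb.measure_lt_top
  -- (7) apply the half-space theorem of Escauriaza–Seregin–Šverák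
  have hESS := ess_backward_uniqueness_holds 3 3 e hen u ((t₂ - t₁) * K * (β⁻¹ + 1))
    (2 * a' * β ^ 2) hC2u hcontu hW hineq hgrowth hz0
  -- (8) read off `v(t, x⋆) = 0` at `s = (t₂ − t)/(t₂ − t₁)`, `y = e`
  obtain ⟨s, hsdef⟩ : ∃ s : ℝ, s = (t₂ - t) / (t₂ - t₁) := ⟨_, rfl⟩
  have hsI : s ∈ Ioo (0 : ℝ) 1 := by
    rw [hsdef]
    constructor
    · exact div_pos (by linarith [htI.2]) hα0
    · rw [div_lt_one hα0]; linarith [htI.1]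
  have hts : t₂ + -(t₂ - t₁) * s = t := by
    rw [hsdef]; field_simp; ring
  have hye : 0 < ⟪e, e⟫_ℝ := by
    rw [real_inner_self_eq_norm_sq, hen]; norm_num
  have h0 := hESS s hsI e hye
  rw [hu, pull_apply, hts, hX, smul_eq_zero] at h0
  rcases h0 with h0 | h0
  · exact absurd h0 hCi.ne'
  · exact h0

end Summit.NavierStokesRegularity.NavierStokesRegularity.Theorems.Shlygin2026

end
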